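import Summits.ValiantsHypothesis.ValiantsHypothesis.Theorems.LacunarySymmetroidMatrixDescartesNsdPivotLoneTiltedRows

/-!
# `MatrixDescartes` (stmt-ValiantsHypothesis-18050) — the MIRROR rows `(K−1 | 1)` (lone letter ABOVE the pivot) are EXACT FOR EVERY
# `K ≥ 1` as well: rank-one lone letter `= 2K − 1`, free lone letter `= 2K` (reflection `t ↦ 1/t` of the tilted-cluster rows)

HONEST FRAMING.  Cell `pub-symmetroid`, seat `val-sym-mdr-p2` (gen 29); helper file `--supports` the crux
`Theses.LacunarySymmetroid.MatrixDescartes` (OPEN), NO closure claim.  BOOKKEEPING: the reflection `t ↦ 1/t` (tree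
`Pivot.Reverse.pivotPosRoots_reverse`: replacing every exponent `x` by `N − x` keeps the number of positive roots) maps the
`(1 | K−1)` NSD class (lone letter strictly BELOW the pivot exponent) onto the `(K−1 | 1)` class (lone letter strictly ABOVE) and back,
preserving `−J ⪰ 0`, the letters, their ranks and the injectivity of the exponents.  So the exact rows of `…NsdPivotLoneTiltedRows`
transfer verbatim:
* `loneAbove_rankOne_iff_allK (hK : 1 ≤ K) (B)`: a budget is valid for every `2 × 2` NSD pivot pencil with `K` PSD letters, exactly one
  of which — of rank `≤ 1` — lies strictly above the pivot exponent and all others strictly below, IFF `2K − 1 ≤ B` (`⇐` is gen 27's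
  mirror END LAW `NsdLoneRankOne.pivotPosRoots_succ_le_of_lone_above`); `exists_loneAbove_rankOne_eq (3 ≤ K)`: a genuine such pencil with
  EXACTLY `2K − 1` roots;
* `loneAbove_iff_allK (hK : 1 ≤ K) (B)`: lone letter of any rank: valid IFF `2K ≤ B`; `exists_loneAbove_eq (3 ≤ K)`: EXACTLY `2K` roots
  with a full-rank lone letter;
* `K = 5`: `loneAbove_rankOne_five_iff` (`↔ 9 ≤ B`), `loneAbove_five_iff` (`↔ 10 ≤ B`) — gen 28 recorded only «`7 ≤ B` is sufficient at
  `K = 4`» for the mirror class (`NsdLoneRankOneFourSeven.loneAbove_rankOne_four_of_seven_le`).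
With this file the `2 × 2` NSD-pivot table of the census is symmetric and exact at every `K`: supports `(1 | K−1)` and `(K−1 | 1)`,
rank-one or free lone letter, and the unrestricted NSD row (`NsdLoneTiltedRows.nsd_two_iff_allK`).  Nothing here bears on
`MatrixDescartes` in its window, on `DoorA26` / `DoorA34`, on the cell's registers beyond these sub-rows, or on `VP ≠ VNP`.

[folklore] Polynomial reversal (tree `…CensusPivotReverse`); bookkeeping over this seat's rows (gen 29).
-/

set_option linter.dupNamespace false

namespace Summit.ValiantsHypothesis.ValiantsHypothesis.Theorems.LacunarySymmetroidMatrixDescartes.Pivot.NsdLoneMirrorRows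

open Polynomial Matrix Finset NsdLoneTiltedRows
open scoped BigOperators

/-! ## 1. Reversal bookkeeping -/

/-- A common bound for the exponents of a pivot pencil. [bookkeeping] -/
theorem exponents_le_bound {K : ℕ} (e : ℕ) (d : Fin K → ℕ) :
    e ≤ e + ∑ k, d k ∧ ∀ k, d k ≤ e + ∑ k, d k :=
  ⟨Nat.le_add_right _ _, fun k =>
    (Finset.single_le_sum (fun i _ => Nat.zero_le (d i)) (Finset.mem_univ k)).trans (Nat.le_add_left _ _)⟩

/-- Reversal keeps injectivity of the exponents. [bookkeeping] -/
theorem reverse_injective {K N : ℕ} {d : Fin K → ℕ} (hd : ∀ k, d k ≤ N) (hinj : Function.Injective d) :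
    Function.Injective (fun k => N - d k) := fun i j h => by
  have hi := hd i; have hj := hd j
  have : d i = d j := by simp only at h; omega
  exact hinj this

/-- **Transfer, rank-one lone letter**: a budget valid for the `(K−1 | 1)` class (lone above) is valid for the `(1 | K−1)` class
(lone below), by reversing the given lone-below pencil. [bookkeeping] -/
theorem loneBelow_valid_of_loneAbove_valid {K B : ℕ}
    (h : ∀ (e : ℕ) (d : Fin K → ℕ) (J : Matrix (Fin 2) (Fin 2) ℝ) (P : Fin K → Matrix (Fin 2) (Fin 2) ℝ) (k₀ : Fin K),
        (-J).PosSemidef → (∀ k, (P k).PosSemidef) → e < d k₀ → (∀ k, k ≠ k₀ → d k < e) → (P k₀).det = 0 →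
        pivotPosRoots e d J P ≤ B) :
    ∀ (e : ℕ) (d : Fin K → ℕ) (J : Matrix (Fin 2) (Fin 2) ℝ) (P : Fin K → Matrix (Fin 2) (Fin 2) ℝ) (k₀ : Fin K),
        (-J).PosSemidef → (∀ k, (P k).PosSemidef) → d k₀ < e → (∀ k, k ≠ k₀ → e < d k) → (P k₀).det = 0 →
        pivotPosRoots e d J P ≤ B := by
  intro e d J P k₀ hJ hP hbot hup hrk
  obtain ⟨he, hd⟩ := exponents_le_bound e d
  rw [← Reverse.pivotPosRoots_reverse _ e d J P he hd]
  refine h _ _ J P k₀ hJ hP ?_ (fun k hk => ?_) hrk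
  · have := hd k₀; omega
  · have := hup k hk; have := hd k; omega

/-- **Transfer, free lone letter** (no rank condition). [bookkeeping] -/
theorem loneBelow_valid_of_loneAbove_valid_free {K B : ℕ}
    (h : ∀ (e : ℕ) (d : Fin K → ℕ) (J : Matrix (Fin 2) (Fin 2) ℝ) (P : Fin K → Matrix (Fin 2) (Fin 2) ℝ) (k₀ : Fin K),
        (-J).PosSemidef → (∀ k, (P k).PosSemidef) → e < d k₀ → (∀ k, k ≠ k₀ → d k < e) →
        pivotPosRoots e d J P ≤ B) :
    ∀ (e : ℕ) (d : Fin K → ℕ) (J : Matrix (Fin 2) (Fin 2) ℝ) (P : Fin K → Matrix (Fin 2) (Fin 2) ℝ) (k₀ : Fin K),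
        (-J).PosSemidef → (∀ k, (P k).PosSemidef) → d k₀ < e → (∀ k, k ≠ k₀ → e < d k) →
        pivotPosRoots e d J P ≤ B := by
  intro e d J P k₀ hJ hP hbot hup
  obtain ⟨he, hd⟩ := exponents_le_bound e d
  rw [← Reverse.pivotPosRoots_reverse _ e d J P he hd]
  refine h _ _ J P k₀ hJ hP ?_ (fun k hk => ?_)
  · have := hd k₀; omega
  · have := hup k hk; have := hd k; omega

/-! ## 2. The mirror rows, every `K ≥ 1` -/

/-- **THE RANK-ONE-LONE `(K−1 | 1)` NSD ROW (lone letter ABOVE) IS EXACTLY `2K − 1` FOR EVERY `K ≥ 1`.** [folklore] -/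
theorem loneAbove_rankOne_iff_allK {K : ℕ} (hK : 1 ≤ K) (B : ℕ) :
    (∀ (e : ℕ) (d : Fin K → ℕ) (J : Matrix (Fin 2) (Fin 2) ℝ) (P : Fin K → Matrix (Fin 2) (Fin 2) ℝ) (k₀ : Fin K),
        (-J).PosSemidef → (∀ k, (P k).PosSemidef) → e < d k₀ → (∀ k, k ≠ k₀ → d k < e) → (P k₀).det = 0 →
        pivotPosRoots e d J P ≤ B) ↔ 2 * K - 1 ≤ B := by
  refine ⟨fun h => (loneBelow_rankOne_iff_allK hK B).1 (loneBelow_valid_of_loneAbove_valid h),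
    fun hB e d J P k₀ hJ hP htop hlow hrk => ?_⟩
  have h := NsdLoneRankOne.pivotPosRoots_succ_le_of_lone_above e d J P hJ hP k₀ htop hlow hrk
  omega

/-- **THE FREE-LONE `(K−1 | 1)` NSD ROW (lone letter ABOVE, any rank) IS EXACTLY `2K` FOR EVERY `K ≥ 1`.** [folklore] -/
theorem loneAbove_iff_allK {K : ℕ} (hK : 1 ≤ K) (B : ℕ) :
    (∀ (e : ℕ) (d : Fin K → ℕ) (J : Matrix (Fin 2) (Fin 2) ℝ) (P : Fin K → Matrix (Fin 2) (Fin 2) ℝ) (k₀ : Fin K),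
        (-J).PosSemidef → (∀ k, (P k).PosSemidef) → e < d k₀ → (∀ k, k ≠ k₀ → d k < e) →
        pivotPosRoots e d J P ≤ B) ↔ 2 * K ≤ B := by
  refine ⟨fun h => (loneBelow_iff_allK hK B).1 (loneBelow_valid_of_loneAbove_valid_free h),
    fun hB e d J P k₀ hJ hP _ _ => ((nsd_two_iff_allK hK (2 * K)).2 le_rfl e d J P hJ hP).trans hB⟩

/-! ## 3. Exact mirror objects (genuine), every `K ≥ 3` -/

/-- **A genuine `(K−1 | 1)` NSD pencil with a rank-one lone letter above and EXACTLY `2K − 1` positive roots** (`K ≥ 3`; the reflected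
tilted cluster). [folklore] -/
theorem exists_loneAbove_rankOne_eq {K : ℕ} (hK : 3 ≤ K) :
    ∃ (e : ℕ) (d : Fin K → ℕ) (J : Matrix (Fin 2) (Fin 2) ℝ) (P : Fin K → Matrix (Fin 2) (Fin 2) ℝ) (k₀ : Fin K),
      (-J).PosSemidef ∧ Function.Injective d ∧ (∀ k, (P k).PosSemidef ∧ P k ≠ 0) ∧ e < d k₀ ∧ (∀ k, k ≠ k₀ → d k < e) ∧
      (P k₀).det = 0 ∧ pivotPosRoots e d J P = 2 * K - 1 := by
  obtain ⟨e, d, J, P, k₀, hJ, hinj, hP, hbot, hup, hrk, hZ⟩ := exists_loneBelow_rankOne_eq hK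
  obtain ⟨he, hd⟩ := exponents_le_bound e d
  set N : ℕ := e + ∑ k, d k
  refine ⟨N - e, fun k => N - d k, J, P, k₀, hJ, reverse_injective hd hinj, hP, ?_, fun k hk => ?_, hrk, ?_⟩
  · have := hd k₀; show N - e < N - d k₀; omega
  · have := hup k hk; have := hd k; show N - d k < N - e; omega
  · rw [Reverse.pivotPosRoots_reverse _ e d J P he hd, hZ]

/-- **A genuine `(K−1 | 1)` NSD pencil with a FULL-RANK lone letter above and EXACTLY `2K` positive roots** (`K ≥ 3`). [folklore] -/
theorem exists_loneAbove_eq {K : ℕ} (hK : 3 ≤ K) :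
    ∃ (e : ℕ) (d : Fin K → ℕ) (J : Matrix (Fin 2) (Fin 2) ℝ) (P : Fin K → Matrix (Fin 2) (Fin 2) ℝ) (k₀ : Fin K),
      (-J).PosSemidef ∧ Function.Injective d ∧ (∀ k, (P k).PosSemidef ∧ P k ≠ 0) ∧ e < d k₀ ∧ (∀ k, k ≠ k₀ → d k < e) ∧
      0 < (P k₀).det ∧ pivotPosRoots e d J P = 2 * K := by
  obtain ⟨e, d, J, P, k₀, hJ, hinj, hP, hbot, hup, hrk, hZ⟩ := exists_loneBelow_eq hK
  obtain ⟨he, hd⟩ := exponents_le_bound e d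
  set N : ℕ := e + ∑ k, d k
  refine ⟨N - e, fun k => N - d k, J, P, k₀, hJ, reverse_injective hd hinj, hP, ?_, fun k hk => ?_, hrk, ?_⟩
  · have := hd k₀; show N - e < N - d k₀; omega
  · have := hup k hk; have := hd k; show N - d k < N - e; omega
  · rw [Reverse.pivotPosRoots_reverse _ e d J P he hd, hZ]

/-! ## 4. `K = 5` -/

/-- **`K = 5`, mirror class, rank-one lone letter above: the `(4 | 1)` NSD row is EXACTLY `9`.** [folklore] -/
theorem loneAbove_rankOne_five_iff (B : ℕ) :
    (∀ (e : ℕ) (d : Fin 5 → ℕ) (J : Matrix (Fin 2) (Fin 2) ℝ) (P : Fin 5 → Matrix (Fin 2) (Fin 2) ℝ) (k₀ : Fin 5),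
        (-J).PosSemidef → (∀ k, (P k).PosSemidef) → e < d k₀ → (∀ k, k ≠ k₀ → d k < e) → (P k₀).det = 0 →
        pivotPosRoots e d J P ≤ B) ↔ 9 ≤ B :=
  loneAbove_rankOne_iff_allK (K := 5) (by norm_num) B

/-- **`K = 5`, mirror class, free lone letter above: the `(4 | 1)` NSD row is EXACTLY `10`.** [folklore] -/
theorem loneAbove_five_iff (B : ℕ) :
    (∀ (e : ℕ) (d : Fin 5 → ℕ) (J : Matrix (Fin 2) (Fin 2) ℝ) (P : Fin 5 → Matrix (Fin 2) (Fin 2) ℝ) (k₀ : Fin 5),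
        (-J).PosSemidef → (∀ k, (P k).PosSemidef) → e < d k₀ → (∀ k, k ≠ k₀ → d k < e) →
        pivotPosRoots e d J P ≤ B) ↔ 10 ≤ B :=
  loneAbove_iff_allK (K := 5) (by norm_num) B

end Summit.ValiantsHypothesis.ValiantsHypothesis.Theorems.LacunarySymmetroidMatrixDescartes.Pivot.NsdLoneMirrorRows
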